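import Summits.ValiantsHypothesis.ValiantsHypothesis.Theorems.BarrierLeverAnchoredDoorHitsLowerPairsStarFacePivot
import Literature.LinearAlgebra.QuadraticForm.DefiniteUnimodularPolynomialLattice

/-!
# Route BarrierLever — support item `AnchoredDoorHitsLowerPairs` (stmt-ValiantsHypothesis-22510), line `anchored_peeling`:
# THE (UNBALANCED) FACE BOND — the first move of the tropical certificate calculus (val-np-p1 g35)

A CLOSURE RULE for the door slot of record `Stmt.conjStarLower` (…StarDoor) at the level of the star-forest matrix. It contains the
face pivot `StarDoor.starDet_ne_zero_of_facePivot` of …StarFacePivot (val-np-p1 g32) as the BALANCED special case and needs no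
balance, no permutation, no injectivity and no lower-set hypothesis.

THE RULE (`starDet_ne_zero_of_faceBond`). Families `u w : Fin r → Finset (Fin h)`, a row vertex `b₀`, a set `T` of column vertices.
The BOND MATRIX at weights `(g, d)` keeps every row avoiding `b₀` as it is and replaces a row `A ∋ b₀` by
`S ↦ [T ⊆ S] · starEntry g d (A − b₀) (S ∖ T)` (the bond «`b₀` is a centre whose leaves are exactly `T`»; zero on the columns not
containing `T`). If the bond matrix is nonsingular for SOME weights, the star-forest block of `(u, w)` is nonsingular for some weights.
With `T = {e₀}` (`starDet_ne_zero_of_bond`) this is the vertex bond; `…_swap` are the column-side versions.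

MECHANISM (the face-pivot line of …StarFacePivot, minus its block-triangular finish). On the polynomial line `g b₀ · = 0`,
`d b₀ e = X · [e ∈ T]` a row through `b₀` has degree `≤ |T|` in `X` with `X^{|T|}`-coefficient the bond row
(`coeff_starEntry_faceRow`), rows avoiding `b₀` are constant; scaling the constant rows by `X^{|T|}`, the `X^{r|T|}`-coefficient of the
determinant is the determinant of the bond matrix (Literature `coeff_det_of_natDegree_le`). So the determinant on the line is a nonzero
polynomial and some complex `X` is good. When as many columns contain `T` as rows contain `b₀` the bond matrix is block triangular and
the rule becomes the face pivot; when FEWER rows contain `b₀` it is an honest unbalanced reduction (the bond matrix is then not block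
triangular); when more rows contain `b₀` the bond matrix is singular and the rule is void.

CONTEXT (memo HOME/val-np-p1/g35/MEMO-valnp1-g35.md, evidence on 22510). This is the simplest instance of the session's TROPICAL
CERTIFICATE CALCULUS: every leaf-role variable `g_{be}` / `d_{be}` has degree `≤ 1` in every (constrained) star entry and is supported on
the rectangle (rows `∋ b`) × (columns `∋ e`), so the top coefficient of the determinant in one such variable — more generally in a set of
role variables sharing one centre, scaled together — is ONE determinant (the leading-coefficient matrix restricted to the tight edges of an
optimal assignment dual); iterating ends in a `0/1` (or monomial) matrix whose nonsingularity certifies the pair. CENSUS OF RECORD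
(kit j337504): every one of the 1 975 canonical lower pairs on `≤ 5+5` vertices and 1 000 random lower pairs on `6+6`, `6+7`, `7+7`
vertices (`r ≤ 46`) has such a certificate (mean search time 0.04 s at `5+5`); CONJECTURE DEG (lab/degtest.py, all 177 pairs on `≤ 4+5`,
all 6 498 variables): for a lower pair the bond matrix of EVERY vertex bond `(b₀, {e₀})` with `#{i : b₀ ∈ u i} ≤ #{j : e₀ ∈ w j}` is
nonsingular for some weights, i.e. `deg_{d_{b₀e₀}} det = min(#rows ∋ b₀, #columns ∋ e₀)`. Neither conjecture is proved here; this file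
does NOT prove `Stmt.conjStarLower`. Nothing here bears on crux 14610 or on `VP ≠ VNP`, which is NOT proved.
-/

set_option linter.dupNamespace false

namespace Summit.ValiantsHypothesis.ValiantsHypothesis.Theorems.BarrierLever.AnchoredPeeling

open Finset Polynomial

noncomputable section

namespace StarDoor

variable {h : ℕ}

section FaceBond

variable {r : ℕ} (u w : Fin r → Finset (Fin h)) (b₀ : Fin h) (T : Finset (Fin h))

/-- **THE FACE BOND (unbalanced face pivot).** The BOND MATRIX of the row vertex `b₀` and the column vertex set `T` at weights `(g, d)`
keeps the star-forest rows avoiding `b₀` and replaces a row `A ∋ b₀` by `S ↦ [T ⊆ S] · starEntry g d (A − b₀) (S ∖ T)`. If it is nonsingular for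
some weights, then the star-forest block of `(u, w)` is nonsingular for some weights. No balance, injectivity or lower-set hypothesis. -/
theorem starDet_ne_zero_of_faceBond
    (H : ∃ g d : Fin h → Fin h → ℂ, (Matrix.of fun i j : Fin r =>
      if b₀ ∈ u i then (if T ⊆ w j then starEntry g d ((u i).erase b₀) (w j \ T) else 0) else starEntry g d (u i) (w j)).det ≠ 0) :
    ∃ g d : Fin h → Fin h → ℂ, (Matrix.of fun i j : Fin r => starEntry g d (u i) (w j)).det ≠ 0 := by
  classical
  obtain ⟨g, d, hdetN⟩ := H
  -- the star matrix on the face-pivot line, and the same with the constant rows scaled by `X^{|T|}`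
  let MP : Matrix (Fin r) (Fin r) ℂ[X] := Matrix.of fun i j => starEntry (fun b e => if b = b₀ then (0 : ℂ[X]) else C (g b e)) (fun b e => if b = b₀ then (if e ∈ T then (X : ℂ[X]) else 0) else C (d b e)) (u i) (w j)
  let v : Fin r → ℂ[X] := fun i => if b₀ ∈ u i then 1 else X ^ T.card
  let MS : Matrix (Fin r) (Fin r) ℂ[X] := Matrix.of fun i j => v i * MP i j
  have hrow_in : ∀ i, b₀ ∈ u i → u i = insert b₀ ((u i).erase b₀) := fun i hi => (Finset.insert_erase hi).symm
  have hdeg : ∀ i j, (MS i j).natDegree ≤ T.card := by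
    intro i j
    simp only [MS, MP, v, Matrix.of_apply]
    by_cases hi : b₀ ∈ u i
    · rw [if_pos hi, one_mul, hrow_in i hi]
      exact natDegree_starEntry_faceRow_le g d b₀ T (Finset.notMem_erase b₀ (u i)) (w j)
    · rw [if_neg hi, starEntry_fp_of_notMem g d b₀ T hi, mul_comm]
      exact natDegree_C_mul_X_pow_le _ _
  let N : Matrix (Fin r) (Fin r) ℂ := Matrix.of fun i j =>
    if b₀ ∈ u i then (if T ⊆ w j then starEntry g d ((u i).erase b₀) (w j \ T) else 0) else starEntry g d (u i) (w j)
  have hcoefN : (MS.map fun p => p.coeff T.card) = N := by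
    ext i j
    simp only [MS, MP, v, N, Matrix.map_apply, Matrix.of_apply]
    by_cases hi : b₀ ∈ u i
    · rw [if_pos hi, if_pos hi, one_mul]
      conv_lhs => rw [hrow_in i hi]
      exact coeff_starEntry_faceRow g d b₀ T (Finset.notMem_erase b₀ (u i)) (w j)
    · rw [if_neg hi, if_neg hi, starEntry_fp_of_notMem g d b₀ T hi, mul_comm, coeff_C_mul_X_pow]
      simp
  -- the top coefficient of `det MS` is `det N`, hence `det MS ≠ 0` and `det MP ≠ 0`
  have hcoef : (MS.det).coeff (Fintype.card (Fin r) * T.card) = N.det := by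
    rw [Literature.AlgebraicGeometry.DeterminantalHypersurfaces.coeff_det_of_natDegree_le MS T.card hdeg, hcoefN]
  have hMS : MS.det ≠ 0 := by
    intro h0
    apply hdetN
    rw [← hcoef, h0, coeff_zero]
  have hMSeq : MS = Matrix.diagonal v * MP := by
    ext i j
    simp only [MS, Matrix.of_apply, Matrix.diagonal_mul]
  have hMP : MP.det ≠ 0 := by
    intro h0
    apply hMS
    rw [hMSeq, Matrix.det_mul, h0, mul_zero]
  -- a nonzero complex polynomial has a non-root
  have hex : ∃ t : ℂ, ¬ (MP.det).IsRoot t := by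
    by_contra hall
    push Not at hall
    apply hMP
    apply Polynomial.eq_zero_of_infinite_isRoot
    have huniv : {x : ℂ | (MP.det).IsRoot x} = Set.univ := Set.eq_univ_of_forall fun x => hall x
    rw [huniv]
    exact Set.infinite_univ
  obtain ⟨t, ht⟩ := hex
  refine ⟨fun b e => Polynomial.eval t ((fun b e => if b = b₀ then (0 : ℂ[X]) else C (g b e)) b e), fun b e => Polynomial.eval t ((fun b e => if b = b₀ then (if e ∈ T then (X : ℂ[X]) else 0) else C (d b e)) b e), ?_⟩
  have hev : Polynomial.eval t MP.det =
      (Matrix.of fun i j : Fin r => starEntry (fun b e => Polynomial.eval t ((fun b e => if b = b₀ then (0 : ℂ[X]) else C (g b e)) b e))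
        (fun b e => Polynomial.eval t ((fun b e => if b = b₀ then (if e ∈ T then (X : ℂ[X]) else 0) else C (d b e)) b e)) (u i) (w j)).det := by
    rw [← Polynomial.coe_evalRingHom, RingHom.map_det, RingHom.mapMatrix_apply]
    congr 1; ext i j; simp only [MP, Matrix.map_apply, Matrix.of_apply]; rw [map_starEntry]
  rw [← hev]
  exact ht

/-- **THE VERTEX BOND** `b₀ → e₀` (`T = {e₀}`): if the matrix «rows avoiding `b₀` unchanged; a row `A ∋ b₀` replaced by
`S ↦ [e₀ ∈ S] · starEntry g d (A − b₀) (S − e₀)`» is nonsingular for some weights, the star-forest block of `(u, w)` is nonsingular for some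
weights. (When `#{i : b₀ ∈ u i} = #{j : e₀ ∈ w j}` this is the vertex pivot; CONJECTURE DEG says the hypothesis holds for every lower pair and
every `(b₀, e₀)` with `#{i : b₀ ∈ u i} ≤ #{j : e₀ ∈ w j}`.) -/
theorem starDet_ne_zero_of_bond (e₀ : Fin h)
    (H : ∃ g d : Fin h → Fin h → ℂ, (Matrix.of fun i j : Fin r =>
      if b₀ ∈ u i then (if e₀ ∈ w j then starEntry g d ((u i).erase b₀) ((w j).erase e₀) else 0) else starEntry g d (u i) (w j)).det ≠ 0) :
    ∃ g d : Fin h → Fin h → ℂ, (Matrix.of fun i j : Fin r => starEntry g d (u i) (w j)).det ≠ 0 := by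
  classical
  obtain ⟨g, d, hd⟩ := H
  refine starDet_ne_zero_of_faceBond u w b₀ {e₀} ⟨g, d, ?_⟩
  have hmat : (Matrix.of fun i j : Fin r =>
      if b₀ ∈ u i then (if ({e₀} : Finset (Fin h)) ⊆ w j then starEntry g d ((u i).erase b₀) (w j \ {e₀}) else 0) else starEntry g d (u i) (w j))
      = (Matrix.of fun i j : Fin r =>
      if b₀ ∈ u i then (if e₀ ∈ w j then starEntry g d ((u i).erase b₀) ((w j).erase e₀) else 0) else starEntry g d (u i) (w j)) := by
    ext i j
    simp only [Matrix.of_apply, Finset.singleton_subset_iff, Finset.sdiff_singleton_eq_erase]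
  rw [hmat]
  exact hd

/-- **THE FACE BOND, swapped orientation:** a column vertex `e₀` and a set `A₀` of row vertices; the bond matrix keeps every column
avoiding `e₀` and replaces a column `S ∋ e₀` by `A ↦ [A₀ ⊆ A] · starEntry g d (A ∖ A₀) (S − e₀)`. -/
theorem starDet_ne_zero_of_faceBond_swap (e₀ : Fin h) (A₀ : Finset (Fin h))
    (H : ∃ g d : Fin h → Fin h → ℂ, (Matrix.of fun i j : Fin r =>
      if e₀ ∈ w j then (if A₀ ⊆ u i then starEntry g d (u i \ A₀) ((w j).erase e₀) else 0) else starEntry g d (u i) (w j)).det ≠ 0) :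
    ∃ g d : Fin h → Fin h → ℂ, (Matrix.of fun i j : Fin r => starEntry g d (u i) (w j)).det ≠ 0 := by
  classical
  obtain ⟨g, d, hd⟩ := H
  -- transport to the swapped pair `(w, u)`
  have H' : ∃ g d : Fin h → Fin h → ℂ, (Matrix.of fun i j : Fin r =>
      if e₀ ∈ w i then (if A₀ ⊆ u j then starEntry g d ((w i).erase e₀) (u j \ A₀) else 0) else starEntry g d (w i) (u j)).det ≠ 0 := by
    refine ⟨fun e b => d b e, fun e b => g b e, ?_⟩
    have hmat : (Matrix.of fun i j : Fin r =>
        if e₀ ∈ w i then (if A₀ ⊆ u j then starEntry (fun e b => d b e) (fun e b => g b e) ((w i).erase e₀) (u j \ A₀) else 0)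
        else starEntry (fun e b => d b e) (fun e b => g b e) (w i) (u j)) = (Matrix.of fun i j : Fin r =>
        if e₀ ∈ w j then (if A₀ ⊆ u i then starEntry g d (u i \ A₀) ((w j).erase e₀) else 0) else starEntry g d (u i) (w j)).transpose := by
      ext i j
      simp only [Matrix.of_apply, Matrix.transpose_apply]
      by_cases hi : e₀ ∈ w i
      · rw [if_pos hi, if_pos hi]
        by_cases hj : A₀ ⊆ u j
        · rw [if_pos hj, if_pos hj, ← starEntry_swap]
        · rw [if_neg hj, if_neg hj]
      · rw [if_neg hi, if_neg hi, ← starEntry_swap]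
    rw [hmat, Matrix.det_transpose]
    exact hd
  obtain ⟨g', d', hdet⟩ := starDet_ne_zero_of_faceBond w u e₀ A₀ H'
  refine ⟨fun b e => d' e b, fun b e => g' e b, ?_⟩
  have hmat : (Matrix.of fun i j : Fin r => starEntry (fun b e => d' e b) (fun b e => g' e b) (u i) (w j))
      = (Matrix.of fun i j : Fin r => starEntry g' d' (w i) (u j)).transpose := by
    ext i j
    simp only [Matrix.of_apply, Matrix.transpose_apply]
    rw [starEntry_swap]
  rw [hmat, Matrix.det_transpose]
  exact hdet

/-- **THE VERTEX BOND, swapped orientation** (`A₀ = {b₀}`): a column `S ∋ e₀` is replaced by `A ↦ [b₀ ∈ A] · starEntry g d (A − b₀) (S − e₀)`,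
columns avoiding `e₀` are unchanged. -/
theorem starDet_ne_zero_of_bond_swap (e₀ : Fin h)
    (H : ∃ g d : Fin h → Fin h → ℂ, (Matrix.of fun i j : Fin r =>
      if e₀ ∈ w j then (if b₀ ∈ u i then starEntry g d ((u i).erase b₀) ((w j).erase e₀) else 0) else starEntry g d (u i) (w j)).det ≠ 0) :
    ∃ g d : Fin h → Fin h → ℂ, (Matrix.of fun i j : Fin r => starEntry g d (u i) (w j)).det ≠ 0 := by
  classical
  obtain ⟨g, d, hd⟩ := H
  refine starDet_ne_zero_of_faceBond_swap u w e₀ {b₀} ⟨g, d, ?_⟩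
  have hmat : (Matrix.of fun i j : Fin r =>
      if e₀ ∈ w j then (if ({b₀} : Finset (Fin h)) ⊆ u i then starEntry g d (u i \ {b₀}) ((w j).erase e₀) else 0) else starEntry g d (u i) (w j))
      = (Matrix.of fun i j : Fin r =>
      if e₀ ∈ w j then (if b₀ ∈ u i then starEntry g d ((u i).erase b₀) ((w j).erase e₀) else 0) else starEntry g d (u i) (w j)) := by
    ext i j
    simp only [Matrix.of_apply, Finset.singleton_subset_iff, Finset.sdiff_singleton_eq_erase]
  rw [hmat]
  exact hd

end FaceBond

/-! ## The engine of the tropical calculus: top coefficient of a determinant under row + column potentials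

(val-np-p1 g35, appended.) A GROUP MOVE of the calculus scales a set of role variables sharing one centre by `s`; the entries then have
`s`-degrees `δ i j` bounded by `u i + v j` for an optimal assignment dual `(u, v)`, and the coefficient of `s^{Σ u + Σ v}` in the determinant
is the determinant of the `(u i + v j)`-coefficients — nonzero exactly on the tight entries. This is the row-and-column-potential form of
Literature `coeff_det_of_natDegree_le` / `coeff_det_of_natDegree_le_add` (there with column potentials only, resp. `u = v`); the product lemma
`coeff_prod_of_natDegree_le_fun` is reused from Literature/LinearAlgebra/QuadraticForm. -/

section Engine

variable {R : Type*} [CommRing R]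

/-- **Top coefficient of a determinant under row and column potentials.** If `deg Gᵢⱼ ≤ uᵢ + vⱼ` for all `i, j`, then the coefficient of
`X^{Σ uᵢ + Σ vⱼ}` in `det G` is the determinant of the matrix of `(uᵢ + vⱼ)`-coefficients (an entry with `deg Gᵢⱼ < uᵢ + vⱼ` contributes `0`:
only the TIGHT entries survive). With `(u, v)` an optimal dual of the assignment problem `max_π Σᵢ deg G_{i π i}` this is the tropical
leading-coefficient lemma behind every move of the certificate calculus. -/
theorem coeff_det_of_natDegree_le_potential {n : Type*} [Fintype n] [DecidableEq n] (G : Matrix n n R[X]) (u v : n → ℕ)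
    (hG : ∀ i j, (G i j).natDegree ≤ u i + v j) :
    (G.det).coeff (∑ i, u i + ∑ j, v j) = (Matrix.of fun i j => (G i j).coeff (u i + v j)).det := by
  rw [Matrix.det_apply, Matrix.det_apply, finsetSum_coeff]
  refine Finset.sum_congr rfl fun σ _ => ?_
  rw [coeff_smul]
  congr 1
  have hsum : ∑ i, u i + ∑ j, v j = ∑ i, (u (σ i) + v i) := by
    rw [Finset.sum_add_distrib, Equiv.sum_comp σ u]
  rw [hsum, Literature.LinearAlgebra.QuadraticForm.coeff_prod_of_natDegree_le_fun _ _ _ fun i _ => hG (σ i) i]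
  simp only [Matrix.of_apply]

end Engine

end StarDoor

end

end Summit.ValiantsHypothesis.ValiantsHypothesis.Theorems.BarrierLever.AnchoredPeeling
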